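import Literature.IUT.HodgeTheaters.GlobalFrobenioidsCyclotomes
import Literature.IUT.HodgeTheaters.GlobalFrobenioidsCyclotomeRigidityZHat
import HarnessLib

/-!
# [IUTchI] Example 5.1 (v), p. 128, SECOND display (the `†𝕄^⊛` case): the unique isomorphism of
# cyclotomes `μ^Θ_Ẑ(π₁(†𝒟^⊚)) ⥲ μ_Ẑ(†𝕄^⊛)` — derived AT THE PRINTED GROUND, i.e. from the
# compatibility with the integral submonoids `𝒪^⊿_𝔭`

S. Mochizuki, *Inter-universal Teichmüller theory I*, kurims manuscript (May 2020), §5, Example 5.1 (v),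
p. 128 l. 25–49 [claim: Mochizuki2012, status: disputed]: "In a similar vein, it follows immediately from
the theory summarized in [AbsTopIII], Theorem 1.9, (d), that there exists a unique isomorphism of
cyclotomes `μ^Θ_Ẑ(π₁(†𝒟^⊚)) ⥲ μ_Ẑ(†𝕄^⊛)` such that the resulting isomorphism between direct limits of
cohomology modules induces isomorphisms `𝕄^⊛(†𝒟^⊚) ⥲ †𝕄^⊛`, `𝕄^⊛_sol(†𝒟^⊚) ⥲ †𝕄^⊛_sol`,
`𝕄^⊛_mod(†𝒟^⊚) ⥲ †𝕄^⊛_mod` [i.e., of monoids equipped with continuous actions by `π₁(†𝒟^⊛)`] in a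
fashion that is compatible with the integral submonoids "`𝒪^⊿_𝔭`" [cf. the discussion of (iv)],
relative to the ring structure constructed in [AbsTopIII], Theorem 1.9, (e), on the domains of these
isomorphisms."  Here `†𝕄^⊛` is the pair `π₁(†𝒟^⊛) ↷ Õ^⊛×` of (iv), p. 126 l. 19–26: "`𝒪^×(A^birat)` may be
naturally identified with the multiplicative group of nonzero elements of the number field
corresponding to `A`", and `𝒪^⊿_𝔭 ⊆ 𝒪^×(A^birat)` is "the submonoid of integral elements of
`𝒪^×(A^birat)` with respect to the valuation determined by `𝔭`" (p. 126 l. 35–38).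

Cell abc-iut, sub-DAG `plan/L5/SUBDAG-IUTchI-Ex51.md` row E51/L28 (index seat abc-iut-w5-d110);
FACT-LIST F-2577 `UniqueCyclotomeIsoFamily` (abc-iut-L5-t12's predicate over the free data
`CyclotomeComparisonFamily`, whose such-that clause `InducesCompatibleIsos` ALREADY carries the
`𝒪^⊿_𝔭`-compatibility as its second conjunct).  Companion of abc-iut-w5-d110's
`GlobalFrobenioidsCyclotomeIsoOfLaws.lean` (`UniqueCyclotomeIsoFamily.of_laws`), written after the
RQ7 audit of that file by abc-iut-w4-d057 (gen 4): there the family statement is derived from the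
Remark 3.1.7 (i) law pair "some class has two distinct ZEROES / every class has at most one POLE" at one
layer `i₀`; but the layers `⊛ / sol / mod` of the `†𝕄^⊛` display are multiplicative GROUPS of constants
(p. 123 l. 20–31, p. 126 l. 19–21), closed under inversion, and on an inversion-closed layer that law pair is
inconsistent for every order function that inversion negates (`zeroPoleLaws_false_of_inv_closed` below) —
so that derivation cannot fire at the printed data.  The present file derives E51/L28 instead from the
clause print names: a unit `u ∈ Ẑ^×` relating two isomorphisms both compatible with the `𝒪^⊿_𝔭` must
preserve the `𝒪^⊿_𝔭`, hence keep ONE positive valuation nonnegative, hence `u = 1`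
(`ℚ_{>0} ∩ Ẑ^× = {1}` in the form `CyclotomeRigidity.eq_one_of_pos_of_nonneg`).

## What is proved (theorems only; the printed inputs are EXPLICIT HYPOTHESES, no definition, no new fact)

* `CyclotomeFamily.zeroPoleLaws_false_of_inv_closed` — the no-go just described (pure order bookkeeping);
* `CyclotomeRigidity.eq_one_of_pos_of_nonneg` — `u ∈ Aut(Ẑ)`, `u(d) = d′` with `d > 0`, `d′ ≥ 0` integers
  ⇒ `u = 1` (from abc-iut-w4-d056's `eq_or_eq_neg_of_apply_eta` / `eq_one_of_apply_eta_self`);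
* `UniqueCyclotomeIsoFamily.of_integral_laws` — **E51/L28**: from
  (E) existence of an isomorphism of cyclotomes satisfying the WHOLE such-that clause,
  (T) TORSOR + FUNCTORIALITY: any two isomorphisms of cyclotomes differ by a unit `u ∈ Ẑ^×`,
  `e′ = zμ u e`, and then `induced e′ = twist u ∘ induced e` ["`Aut(μ_Ẑ) = Ẑ^×`"; functoriality of
  `lim_H H¹(H, −)` in the coefficients],
  (V) VALUATION TRANSPORT on one layer `i₀` [for `x, y` in the number field of the layer with
  `u · κ(x) = κ(y)` one has `u · v_𝔭(x) = v_𝔭(y)` in `Ẑ` — valuations extend continuously to the profinite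
  completions and `Ẑ` is torsion-free, which disposes of ramification indices],
  (I) INTEGRALITY: a class of the layer lying in the integral submonoid at `𝔭` has valuation `≥ 0` at `𝔭`
  [definition of `𝒪^⊿_𝔭`, p. 126], and
  (P) ONE class of the layer integral at some `𝔭₀` with POSITIVE valuation there [a uniformizer],
  the printed `∃!` holds.  At the printed data every law holds with `i₀ = mod` (`F_mod^×`, integer-valued
  valuations indexed by `Prime(†ℱ^⊛_mod) ⥲ 𝕍_mod`, p. 129); the construction of that data is the
  Kummer-map / [AbsTopIII] Thm 1.9 merge (campaign L), not done here.

HONEST FRAMING: (E), (T), (V), (I), (P) are typed, not proved; nothing here asserts a disputed claim or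
takes a side on [IUTchIII] Cor. 3.12; typed ≠ proved.
-/

namespace Literature.IUT.HodgeTheaters

open ProfiniteGrp ProfiniteGrp.ProfiniteCompletion
open Literature.AnabelianGeometry.EtaleTheta Literature.AnabelianGeometry.EtaleTheta.ZHatLevel

universe u v w w'

/-! ### The Remark 3.1.7 (i) law pair cannot be instantiated on an inversion-closed layer -/

/-- **No-go for the zero/pole law pair on a group layer.**  Let `S ⊆ H` be a set of classes and
`ord : Pt → H → ℤ` any "order" function such that every `h ∈ S` has a companion `h′ ∈ S` with
`ord_x h′ = −ord_x h` for all `x` [at the printed `†𝕄^⊛` data: `S` = the Kummer classes of a multiplicative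
GROUP of constants `F̄^×`, `F_mod^×` (p. 123, p. 126), `h′ = h⁻¹ = twist(−1) h`, and ANY `ord` satisfying the
divisor-transport law at `u = −1`].  Then "some class in `S` has positive order at two distinct points" and
"no class in `S` has negative order at two distinct points" contradict each other.  Consequently the
hypotheses `htwo`/`hone` of `UniqueCyclotomeIsoFamily.of_laws` are unsatisfiable at the layers
`⊛ / sol / mod` of the second display of (v). ([IUTchI] Ex 5.1 (v) p.128)
[claim: Mochizuki2012, status: disputed] -/
theorem CyclotomeFamily.zeroPoleLaws_false_of_inv_closed {H : Type u} {Pt : Type v} (S : Set H)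
    (ord : Pt → H → ℤ) (hinv : ∀ h ∈ S, ∃ h' ∈ S, ∀ x, ord x h' = -ord x h)
    (htwo : ∃ h ∈ S, ∃ x₁ x₂ : Pt, x₁ ≠ x₂ ∧ 0 < ord x₁ h ∧ 0 < ord x₂ h)
    (hone : ∀ h ∈ S, ∀ x₁ x₂ : Pt, x₁ ≠ x₂ → ¬ (ord x₁ h < 0 ∧ ord x₂ h < 0)) : False := by
  obtain ⟨h, hh, x₁, x₂, hne, h₁, h₂⟩ := htwo
  obtain ⟨h', hh', hord'⟩ := hinv h hh
  refine hone h' hh' x₁ x₂ hne ⟨?_, ?_⟩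
  · rw [hord']; omega
  · rw [hord']; omega

/-! ### `ℚ_{>0} ∩ Ẑ^× = {1}` in the form the integral submonoids use -/

/-- **`ℚ_{>0} ∩ Ẑ^× = {1}`, one-valuation form.**  An element `u` of `Ẑ^× = Aut(Ẑ)` carrying a POSITIVE
integer `d` [the valuation at `𝔭₀` of a class integral at `𝔭₀`] to a NONNEGATIVE integer `d′` [the valuation
of its `u`-twist, again integral at `𝔭₀` by compatibility with `𝒪^⊿_{𝔭₀}`] is the identity: by
abc-iut-w4-d056's `eq_or_eq_neg_of_apply_eta`, `d′ = ±d`, and the sign excludes `−d`.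
([IUTchI] Ex 5.1 (v) p.128) [claim: Mochizuki2012, status: disputed] -/
theorem CyclotomeRigidity.eq_one_of_pos_of_nonneg (u : MulAut (completion (GrpCat.of (Multiplicative ℤ))))
    {d d' : ℤ} (hd : 0 < d) (hd' : 0 ≤ d') (h : u (eta d) = eta d') : u = 1 := by
  have hd0 : d ≠ 0 := ne_of_gt hd
  rcases CyclotomeRigidity.eq_or_eq_neg_of_apply_eta u hd0 h with h1 | h1
  · subst h1
    exact CyclotomeRigidity.eq_one_of_apply_eta_self u hd0 h
  · exact absurd h1 (by omega)

/-! ### E51/L28 at the printed ground: compatibility with the integral submonoids `𝒪^⊿_𝔭` -/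

/-- **Ex. 5.1 (v), p. 128 l. 25–49 — `UniqueCyclotomeIsoFamily C` FROM THE PRINTED INPUTS, via the
integral submonoids.**  Let `C` be abc-iut-L5-t12's comparison family (layers `im₁ i, im₂ i`, integral
submonoids `int₁ 𝔭, int₂ 𝔭`, container map `induced e`), `zμ` an action of `Ẑ^× = Aut(Ẑ)` on the
isomorphisms of cyclotomes with `zμ 1 = id`, `twist` one on the target container, `i₀` one layer
[`mod`, i.e. `F_mod^×`] and `val 𝔭 : H₂ → ℤ` the valuation at `𝔭` read on the classes of that layer
[arbitrary elsewhere].  Suppose: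
(E) some isomorphism of cyclotomes satisfies the whole such-that clause `C.InducesCompatibleIsos`;
(T) for all `e, e′` there is `u ∈ Ẑ^×` with `e′ = zμ u e` and `induced e′ = twist u ∘ induced e`;
(V) a unit `u` whose container action preserves the layer `i₀` transports valuations there,
`u(val_𝔭 h) = val_𝔭(twist u h)` in `Ẑ`;
(I) classes of the layer lying in `int₂ 𝔭` have `val_𝔭 ≥ 0`;
(P) some class of the layer lies in `int₂ 𝔭₀` with `val_{𝔭₀} > 0`.
Then there is EXACTLY ONE isomorphism of cyclotomes satisfying the such-that clause: for two of them the
unit `u` of (T) preserves the layer AND every `int₂ 𝔭`, so by (V), (I), (P) it keeps one positive valuation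
nonnegative, whence `u = 1` (`CyclotomeRigidity.eq_one_of_pos_of_nonneg`).
([IUTchI] Ex 5.1 (v) p.128) [claim: Mochizuki2012, status: disputed] -/
theorem UniqueCyclotomeIsoFamily.of_integral_laws {ι : Type w} {𝔓 : Type w'}
    (C : CyclotomeComparisonFamily ι 𝔓) (i₀ : ι)
    (zμ : MulAut (completion (GrpCat.of (Multiplicative ℤ))) → (C.μ₁ ≃* C.μ₂) → (C.μ₁ ≃* C.μ₂))
    (hzμ_one : ∀ e, zμ 1 e = e)
    (twist : MulAut (completion (GrpCat.of (Multiplicative ℤ))) → C.H₂ → C.H₂)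
    (hex : ∃ e, C.InducesCompatibleIsos e)
    (htors : ∀ e e' : C.μ₁ ≃* C.μ₂, ∃ u : MulAut (completion (GrpCat.of (Multiplicative ℤ))),
      e' = zμ u e ∧ ∀ h, C.induced e' h = twist u (C.induced e h))
    (val : 𝔓 → C.H₂ → ℤ)
    (hval : ∀ u : MulAut (completion (GrpCat.of (Multiplicative ℤ))),
      Set.MapsTo (twist u) (C.im₂ i₀) (C.im₂ i₀) →
        ∀ h ∈ C.im₂ i₀, ∀ 𝔭 : 𝔓, u (eta (val 𝔭 h)) = eta (val 𝔭 (twist u h)))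
    (hint : ∀ 𝔭 : 𝔓, ∀ h ∈ C.im₂ i₀, h ∈ C.int₂ 𝔭 → 0 ≤ val 𝔭 h)
    (hpos : ∃ 𝔭₀ : 𝔓, ∃ h ∈ C.im₂ i₀, h ∈ C.int₂ 𝔭₀ ∧ 0 < val 𝔭₀ h) :
    UniqueCyclotomeIsoFamily C := by
  obtain ⟨e₀, he₀⟩ := hex
  refine ⟨⟨e₀, he₀, fun e he => ?_⟩⟩
  -- `e` and `e₀` differ by a unit `u`, the induced maps by its container action
  obtain ⟨u, hue, hu⟩ := htors e₀ e
  -- `twist u` preserves the layer `i₀` …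
  have hmaps : Set.MapsTo (twist u) (C.im₂ i₀) (C.im₂ i₀) := by
    intro h hh
    obtain ⟨h₁, hh₁, rfl⟩ := (he₀.1 i₀).surjOn hh
    rw [← hu h₁]
    exact (he.1 i₀).mapsTo hh₁
  -- … and every integral submonoid `𝒪^⊿_𝔭` (the clause print names)
  have hmapsInt : ∀ 𝔭 : 𝔓, Set.MapsTo (twist u) (C.int₂ 𝔭) (C.int₂ 𝔭) := by
    intro 𝔭 h hh
    obtain ⟨h₁, hh₁, rfl⟩ := (he₀.2 𝔭).surjOn hh
    rw [← hu h₁]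
    exact (he.2 𝔭).mapsTo hh₁
  -- one positive valuation stays nonnegative: `ℚ_{>0} ∩ Ẑ^× = {1}` forces `u = 1`
  obtain ⟨𝔭₀, h, hh, hhint, hposv⟩ := hpos
  have hu1 : u = 1 :=
    CyclotomeRigidity.eq_one_of_pos_of_nonneg u hposv
      (hint 𝔭₀ (twist u h) (hmaps hh) (hmapsInt 𝔭₀ hhint)) (hval u hmaps h hh 𝔭₀)
  rw [hue, hu1, hzμ_one]

/-- Under the same laws the container maps of ANY two isomorphisms of cyclotomes satisfying the
such-that clause agree (container-level uniqueness, independent of the `zμ`-bookkeeping; needs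
`twist 1 = id` instead). ([IUTchI] Ex 5.1 (v) p.128) [claim: Mochizuki2012, status: disputed] -/
theorem CyclotomeComparisonFamily.induced_eq_of_integral_laws {ι : Type w} {𝔓 : Type w'}
    (C : CyclotomeComparisonFamily ι 𝔓) (i₀ : ι)
    (twist : MulAut (completion (GrpCat.of (Multiplicative ℤ))) → C.H₂ → C.H₂)
    (htwist_one : ∀ h, twist 1 h = h)
    (htors : ∀ e e' : C.μ₁ ≃* C.μ₂, ∃ u : MulAut (completion (GrpCat.of (Multiplicative ℤ))),
      ∀ h, C.induced e' h = twist u (C.induced e h))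
    (val : 𝔓 → C.H₂ → ℤ)
    (hval : ∀ u : MulAut (completion (GrpCat.of (Multiplicative ℤ))),
      Set.MapsTo (twist u) (C.im₂ i₀) (C.im₂ i₀) →
        ∀ h ∈ C.im₂ i₀, ∀ 𝔭 : 𝔓, u (eta (val 𝔭 h)) = eta (val 𝔭 (twist u h)))
    (hint : ∀ 𝔭 : 𝔓, ∀ h ∈ C.im₂ i₀, h ∈ C.int₂ 𝔭 → 0 ≤ val 𝔭 h)
    (hpos : ∃ 𝔭₀ : 𝔓, ∃ h ∈ C.im₂ i₀, h ∈ C.int₂ 𝔭₀ ∧ 0 < val 𝔭₀ h)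
    {e₀ e : C.μ₁ ≃* C.μ₂} (he₀ : C.InducesCompatibleIsos e₀) (he : C.InducesCompatibleIsos e) :
    ∀ h, C.induced e h = C.induced e₀ h := by
  obtain ⟨u, hu⟩ := htors e₀ e
  have hmaps : Set.MapsTo (twist u) (C.im₂ i₀) (C.im₂ i₀) := by
    intro h hh
    obtain ⟨h₁, hh₁, rfl⟩ := (he₀.1 i₀).surjOn hh
    rw [← hu h₁]
    exact (he.1 i₀).mapsTo hh₁
  have hmapsInt : ∀ 𝔭 : 𝔓, Set.MapsTo (twist u) (C.int₂ 𝔭) (C.int₂ 𝔭) := by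
    intro 𝔭 h hh
    obtain ⟨h₁, hh₁, rfl⟩ := (he₀.2 𝔭).surjOn hh
    rw [← hu h₁]
    exact (he.2 𝔭).mapsTo hh₁
  obtain ⟨𝔭₀, h, hh, hhint, hposv⟩ := hpos
  have hu1 : u = 1 :=
    CyclotomeRigidity.eq_one_of_pos_of_nonneg u hposv
      (hint 𝔭₀ (twist u h) (hmaps hh) (hmapsInt 𝔭₀ hhint)) (hval u hmaps h hh 𝔭₀)
  intro h'
  rw [hu h', hu1, htwist_one]

end Literature.IUT.HodgeTheaters
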